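import Summits.BirchSwinnertonDyer.BirchSwinnertonDyer.Theorems.SchneiderFreeAdditiveX3KYMuZeroOfCharacterFiniteness
import Summits.BirchSwinnertonDyer.BirchSwinnertonDyer.Theorems.SchneiderFreeAdditiveX3SemistableTwistLocalNonAnomalous
import Summits.BirchSwinnertonDyer.BirchSwinnertonDyer.Theorems.EisensteinPrimesKellerYinLemma511NonsplitOfPrint
import HarnessLib

/-!
# Route `SchneiderFreeAdditiveX3` (K1 door): the `μ`-clause [INV.μ] "`μ(𝔛) = 0`" and the `Λ`-torsion clause of Keller–Yin
# Thm. 3.5.1 at `p ≥ 5` FROM PRINT — Castella–Grossi–Lee–Skinner 2022 Prop. 14 (Invent. Math.) — on BOTH semistable-twist cells;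
# the wing's field-local co-socket at `p ≥ 5` on {[DIV]} + published facts

Cell `bsd-schneider-ideate`, seat `bsd-schneider-door-c5` (prover, generation 23; assembly layer; `--supports` 19177).
PARTITION: board row B6 ∩ X3 ∩ sst-twist, `r = 1` (7 101 pairs), at `p ≥ 5`; types-the-object-of nothing new; moves the
algebraic `μ`-input of crux r3 / wing r3 from PREPRINT to PUBLISHED at `p ≥ 5`; closes none of B6's cells (BSD NOT advanced).
bears_on: K1-door (items 18971/18972 → 19177 r3) + K1-wing (20365 r3).

WHAT.  Companion `…KYMuZeroOfCharacterFiniteness` (p662237) derived the two clauses for ALL odd `p` from Keller–Yin 2024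
Prop. 1.2.5's character clause (PREPRINT).  Its printed special case Castella–Grossi–Lee–Skinner 2022 Prop. 14
(`CastellaGrossiLeeSkinner2022.prop14_residualCharacterSelmer_finite`, Invent. Math. 227; Rubin 1991 + Hida 2010) carries the
local hypothesis `θ|_{G_{v̄}} ∉ {1, ω}` — which HOLDS for both Jordan–Hölder characters of `E[p]` when `E = V ⊗ χ_{p*}` with `V`
good ordinary or multiplicative at `p ≥ 5` (characters `ω^{(p±1)/2}` on inertia): companion `…SemistableTwistLocalNonAnomalous`
(p663074).  This file:
* §1 `residualFinite_of_prop14_of_nonAnomalous` — cell `bsd-eis`'s `…Lemma511NonsplitOfPrint.residualFinite_of_prop14_of_not_split`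
  with its ONLY reduction-type-specific step (the non-anomalous clause at the primes above `p`) turned into a HYPOTHESIS `hna`:
  CGLS Prop. 14 ⟹ `Sel_{v̄}^{Sf}(K_∞, E_K[p^∞])[p]` finite at every Eisenstein Heegner datum satisfying `hna`; then torsion +
  `μ = 0` of `X^{Sf}` and of `X^∅` (Greenberg's criterion (A)).
* §2 the semistable-twist cells at `p ≥ 5`: `isTorsion_muInvariant_eq_zero_empty_of_prop14_of_subSemistableTwist` — for
  `ClassX3 W p ∧ SubSemistableTwist W p`, `5 ≤ p`, `K` Heegner for `N_W` with `(p)` split: `X_ac^∅(E_K)` is `Λ`-torsion with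
  `μ = 0` ⟸ CGLS Prop. 14 (PUBLISHED).  I.e. [INV.μ] and [DIV]'s torsion clause of the K1 door AT `p ≥ 5` rest on print.
* §3 the WING's field-local (G-ord, `e = 2`) co-socket at `p ≥ 5` ⇐ Kolyvagin ∧ modularity ∧ Hsieh 2014 Thm A ∧ LZZ 2018 ∧
  Castella–Hsieh signed ∧ CGLS Prop. 14 (all PUBLISHED) ∧ Keller–Yin [DIV] (ONE preprint sentence) — generation 22's (c′) with the
  `μ`-input from §2.

INPUT LEDGER of the (G-ord, `e = 2`) UPPER half at `p ≥ 5` after this file: PUBLISHED {Kolyvagin, modularity, Hsieh A, LZZ, CH signed,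
CGLS Prop 14} + PREPRINT {[DIV] = KY 2410.23241 Thm 3.3.6 ∘ Prop 3.4.4}.  (At `p = 3` — 2 411 of the 2 560 census pairs — the
`μ`-input stays Keller–Yin 2024 Prop. 1.2.5, companion file; the local clause fails there.)

HONEST FRAMING: composition of tree theorems; CONDITIONAL on the displayed hypotheses (CGLS Prop. 14 is a published theorem typed
as a named fact, not proved in the tree; [DIV] is an unrefereed preprint claim); no item closed; BSD is proved for NO curve;
«closes rung: none».

References: Castella–Grossi–Lee–Skinner, Invent. Math. 227 (2022) §1.2 Prop. 14, §1.4 Props. 17–18 [CastellaGrossiLeeSkinner2022];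
Keller–Yin arXiv:2410.23241 Thm. 3.3.6, Prop. 3.4.4, §3.5 [KellerYin2024b]; Keller–Yin arXiv:2402.12781v2 Thm. 1.4.1, Lemma 5.1.1
[KellerYin2024]; Greenberg LNM 1716 §1 p. 60; Greenberg–Vatsal 2000 §2; Serre 1972 §1.11–1.12; Brink 2007 Cor. 1; cell bsd-eis
p626493 (template), this seat p662237, p663074, gen 22 p660770.
-/

set_option autoImplicit false
set_option linter.dupNamespace false -- the summit namespace `…BirchSwinnertonDyer.BirchSwinnertonDyer.Theorems` (Sub = Summit, D-0017) trips it

noncomputable section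

open scoped Classical Pointwise NumberField

open WeierstrassCurve NumberField IsDedekindDomain Field PowerSeries
  Literature.NumberTheory.EllipticCurves Literature.NumberTheory.EllipticCurves.IwasawaAlgebra
  Literature.NumberTheory.EllipticCurves.GreenbergSelmer
  Literature.NumberTheory.EllipticCurves.GreenbergVatsal2000
  Literature.NumberTheory.GaloisRepresentations IsDedekindDomain.HeightOneSpectrum
  Literature.NumberTheory.EllipticCurves.Rank1Residual
  Literature.NumberTheory.EllipticCurves.ModularForms
  Literature.NumberTheory.EllipticCurves.KellerYin2024
  Summit.BirchSwinnertonDyer.Rank1Residual Summit.BirchSwinnertonDyer.Rank1Residual.X11b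
  Summit.BirchSwinnertonDyer.Rank1Residual.X11b.AcSelmer
  Summit.BirchSwinnertonDyer.Rank1Residual.X2.ResidualDevissageModules
  Summit.BirchSwinnertonDyer.BirchSwinnertonDyer.Theorems
  Summit.BirchSwinnertonDyer.BirchSwinnertonDyer.Theorems.CumulativeHeegnerInclusionAtThreeResidualDevissage
  Summit.BirchSwinnertonDyer.BirchSwinnertonDyer.Theorems.CumulativeHeegnerInclusionAtThreeLineBaseChange
  Summit.BirchSwinnertonDyer.BirchSwinnertonDyer.Theorems.CumulativeHeegnerInclusionAtThreeTowerFixed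
  Summit.BirchSwinnertonDyer.BirchSwinnertonDyer.Theorems.CumulativeHeegnerInclusionAtThreeStubB1LineDeterminant
  Summit.BirchSwinnertonDyer.BirchSwinnertonDyer.Theorems.CumulativeHeegnerInclusionAtThreeBadPlaces
  Summit.BirchSwinnertonDyer.BirchSwinnertonDyer.Theorems.AdditiveKoly.SplitCompletion
  Summit.BirchSwinnertonDyer.BirchSwinnertonDyer.Theorems.SchneiderFree
  Summit.BirchSwinnertonDyer.BirchSwinnertonDyer.Theorems.SchneiderFree.Upper
  Summit.BirchSwinnertonDyer.BirchSwinnertonDyer.Theorems.SchneiderFree.KYRead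
  Summit.BirchSwinnertonDyer.BirchSwinnertonDyer.Theorems.SchneiderFreeAdditiveX3.LZZMatch
  Summit.BirchSwinnertonDyer.BirchSwinnertonDyer.Theorems.SchneiderFreeAdditiveX3.ControlDischarged
  Summit.BirchSwinnertonDyer.BirchSwinnertonDyer.Theorems.SchneiderFreeAdditiveX3.KYBranchOnly
  Summit.BirchSwinnertonDyer.BirchSwinnertonDyer.Theorems.SchneiderFreeAdditiveX3.KYBranchHalves
  Summit.BirchSwinnertonDyer.BirchSwinnertonDyer.Theorems.SchneiderFreeAdditiveX3.SemistableTwistLocal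

open Literature.NumberTheory.EllipticCurves.CastellaGrossiLeeSkinner2022 (prop14_residualCharacterSelmer_finite)

namespace Summit.BirchSwinnertonDyer.BirchSwinnertonDyer.Theorems.SchneiderFreeAdditiveX3.KYMuZeroOfPrint

/-! ### §1 CGLS Prop. 14 ⟹ residual finiteness at every Eisenstein Heegner datum with the NON-ANOMALOUS clause — reduction-type-free -/

/-- **CGLS22 Prop. 14 ⟹ `Sel_{v̄}^{Sf}(K_∞, E_K[p^∞])[p]` finite, at every Eisenstein Heegner datum satisfying the NON-ANOMALOUS
clause at the primes above `p`.**  Binders: `W/ℚ` globally minimal, `2 < p`, `E[p]` reducible; `K` imaginary quadratic with the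
Heegner hypothesis for `N_W` and `(p)` split; `v̄ ∋ p`; `κ` anticyclotomic; `Sf` = the places of `K` over `N_W` not over `p`; and
`hna`: for every place `v ∋ p` of `ℚ`, every rational line `Φ ≤ E[p]` and every prime `𝔓` of `\bar ℤ` above `v`, `D_𝔓` does not
fix `Φ` pointwise and does not act trivially on `E[p]/Φ`.  The reduction type of `E` at `p` is NOT used.  This is cell
`bsd-eis`'s `KellerYinLemma511NonsplitOfPrint.residualFinite_of_prop14_of_not_split` VERBATIM with its §1 (the clause at a
non-split multiplicative prime) replaced by the hypothesis `hna`: base change of `Φ` to a `Γ_K`-stable `S ≤ E_K[p]`, degree-one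
transport of the two clauses to `D_{v̄}`, no `G_{K_{∞,v̄}}`-fixed vector in `E_K[p]/S`, CGLS's «`θ|_D ≠ ω`» for both characters
from `φψ = ω`, `Sf`-bookkeeping from (Heeg), unramifiedness off `Sf ∪ {w ∣ p}` by good reduction, Prop. 14 for `S` and
`E_K[p]/S`, the dévissage + Kummer step with Brink's `D_{v̄} ⊄ ker κ`.  CONDITIONAL on the published named fact `hfact`.
[cite: CastellaGrossiLeeSkinner2022, §1.2 Prop. 14, §1.4 Props. 17–18 (arXiv:2008.02571; Invent. Math. 227 (2022))]
[cite: GreenbergVatsal2000, §2 pp. 14–15] [cite: Brink2007, Cor. 1] -/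
theorem residualFinite_of_prop14_of_nonAnomalous
    (hfact : prop14_residualCharacterSelmer_finite)
    {p : ℕ} [hp : Fact p.Prime] (W : WeierstrassCurve ℚ) [W.IsElliptic] [W.IsGloballyMinimal]
    (K : Type) [Field K] [NumberField K] (vbar : HeightOneSpectrum (𝓞 K))
    (κ : ZpExtension K p) (Sf : Finset (HeightOneSpectrum (𝓞 K)))
    (hp2 : 2 < p) (hred : Red W p) (hK : IsImaginaryQuadratic K)
    (hH : SatisfiesHeegnerHypothesis (W.conductorNorm ℤ) K)
    (hsplit : ((Ideal.span {(p : ℤ)}).primesOver (𝓞 K)).ncard = 2)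
    (hvbar : ((p : ℕ) : 𝓞 K) ∈ vbar.asIdeal) (hκ : κ.IsAnticyclotomic)
    (hSf : ∀ w : HeightOneSpectrum (𝓞 K), w ∈ Sf ↔
      (((W.conductorNorm ℤ : ℤ) : 𝓞 K) ∈ w.asIdeal ∧ ((p : ℕ) : 𝓞 K) ∉ w.asIdeal))
    (hna : ∀ (v : HeightOneSpectrum (𝓞 ℚ)), ((p : ℕ) : 𝓞 ℚ) ∈ v.asIdeal →
      ∀ (Φ : AddSubgroup (geomTorsion W (p : ℤ))), IsRationalLine W p Φ →
      ∀ 𝔓 ∈ v.primesAbove,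
        (¬ ∀ g ∈ 𝔓.decompositionSubgroup (absoluteGaloisGroup ℚ), ∀ P ∈ Φ, g • P = P) ∧
          (¬ ∀ g ∈ 𝔓.decompositionSubgroup (absoluteGaloisGroup ℚ),
            ∀ P : geomTorsion W (p : ℤ), g • P - P ∈ Φ)) :
    Set.Finite {s : selmerAc (W.baseChange K) p κ vbar (↑Sf : Set (HeightOneSpectrum (𝓞 K))) |
      p • s = 0} := by
  have hpp : p.Prime := hp.out
  have hp2' : p ≠ 2 := by omega
  haveI hEK : (W.baseChange K).IsElliptic := inferInstanceAs (W.map (algebraMap ℚ K)).IsElliptic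
  haveI : IsGalois ℚ K := isGalois_of_finrank_eq_two K hK.1
  /- `(p)` splits: `e(v̄|p) = f(v̄|p) = 1` -/
  have he : vbar.asIdeal.ramificationIdx (𝓞 ℚ) = 1 :=
    ramificationIdx_eq_one_of_card_primesOver K p hK.1 hsplit vbar hvbar
  have hf : vbar.asIdeal.inertiaDeg (𝓞 ℚ) = 1 :=
    inertiaDeg_eq_one_of_card_primesOver K p hK.1 hsplit vbar hvbar
  set v : HeightOneSpectrum (𝓞 ℚ) := vbar.under (𝓞 ℚ) with hv
  have hw : vbar.asIdeal.under (𝓞 ℚ) = v.asIdeal := by rw [hv, HeightOneSpectrum.under_asIdeal]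
  have hpv : ((p : ℕ) : 𝓞 ℚ) ∈ v.asIdeal := natCast_mem_under K p vbar hvbar
  /- a rational line and the non-anomalous clause at every prime above `p` (hypothesis) -/
  obtain ⟨Φ, hΦ⟩ := exists_isRationalLine_of_not_irr W p hred
  have hcell : ∀ 𝔓 ∈ v.primesAbove,
      (¬ ∀ g ∈ 𝔓.decompositionSubgroup (absoluteGaloisGroup ℚ), ∀ P ∈ Φ, g • P = P) ∧
        (¬ ∀ g ∈ 𝔓.decompositionSubgroup (absoluteGaloisGroup ℚ),
          ∀ P : geomTorsion W (p : ℤ), g • P - P ∈ Φ) :=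
    fun 𝔓 h𝔓 ↦ hna v hpv Φ hΦ 𝔓 h𝔓
  /- the line over `K` -/
  obtain ⟨t, ht⟩ := exists_geomTorsion_baseChange_equiv W K ((p : ℕ) : ℤ)
  have ht' : ∀ (σ : absoluteGaloisGroup K) (P : W.geomTorsion ((p : ℕ) : ℤ)),
      t (absGaloisRestrict ℚ K σ • P) = σ • t P := fun σ P ↦ by
    rw [← resGal_eq_absGaloisRestrict]; exact ht σ P
  obtain ⟨S, hS, hcardS⟩ := exists_stableSubgroup_corr Φ t ht' hΦ.2
  have hSub : Nat.card S.Sub = p := by rw [hcardS, hΦ.1]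
  have hEp : Nat.card ((W.baseChange K).geomTorsion ((p : ℕ) : ℤ)) = p ^ 2 :=
    (W.baseChange K).natCard_geomTorsion_prime_eq_sq hpp
  have hQuot : Nat.card S.Quot = p := by
    have h := S.natCard_eq_mul
    rw [hEp, hSub, sq] at h
    exact (Nat.eq_of_mul_eq_mul_right hpp.pos h).symm
  /- the non-anomalous clause on `decomp v̄` -/
  have hnon1 : ¬ ∀ γ ∈ decomp vbar, ∀ x : S.Sub, γ • x = x :=
    not_forall_decomp_smul_sub_eq_of_corr Φ t ht' S hS
      (not_forall_decomp_smul_eq K Φ hw he hf fun 𝔓 h𝔓 ↦ (hcell 𝔓 h𝔓).1)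
  have hnon2 : ¬ ∀ γ ∈ decomp vbar, ∀ y : S.Quot, γ • y = y :=
    not_forall_decomp_smul_quot_eq_of_corr Φ t ht' S hS
      (not_forall_decomp_smul_sub_mem K Φ hw he hf fun 𝔓 h𝔓 ↦ (hcell 𝔓 h𝔓).2)
  /- no `ker κ ⊓ D_{v̄}`-fixed vector in the quotient -/
  have hfix : ∀ y : S.Quot, (∀ g : ↥(κ.kerSubgroup ⊓ decomp vbar), g • y = y) → y = 0 :=
    eq_zero_of_fixed_of_not_forall_decomp_smul_eq κ vbar hQuot hnon2
  /- CGLS's `θ|D ≠ ω` for both characters, from `φψ = ω` -/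
  have hωS : ¬ ∀ g ∈ decomp vbar, ∀ m : S.Sub,
      g • m = ((modNCyclotomicCharacter K p g : (ZMod p)ˣ) : ZMod p).val • m :=
    not_forall_smul_sub_eq_cyclotomic (W.baseChange K) p S hSub (decomp vbar) hnon2
  have hωQ : ¬ ∀ g ∈ decomp vbar, ∀ m : S.Quot,
      g • m = ((modNCyclotomicCharacter K p g : (ZMod p)ˣ) : ZMod p).val • m :=
    not_forall_smul_quot_eq_cyclotomic (W.baseChange K) p S hSub (decomp vbar) hnon1
  /- the imprimitivity set `Sf`: finite, prime to `p`, over split rational primes; good reduction off it -/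
  set S₀ : Set (HeightOneSpectrum (𝓞 K)) := (↑Sf : Set (HeightOneSpectrum (𝓞 K))) with hS₀
  have hS₀fin : S₀.Finite := Sf.finite_toSet
  have hgood : ∀ w : HeightOneSpectrum (𝓞 K), w ∉ S₀ → ((p : ℕ) : 𝓞 K) ∉ w.asIdeal →
      (W.baseChange K).HasGoodReductionAt w := fun w hw hpw ↦ by
    by_contra hbad
    obtain ⟨ℓ, -, hℓw, hℓN⟩ := exists_prime_mem_dvd_conductorNorm_of_not_hasGoodReductionAt W K w hbad
    apply hw
    rw [hS₀, Finset.mem_coe, hSf]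
    refine ⟨?_, hpw⟩
    obtain ⟨m, hm⟩ := hℓN
    rw [hm, Nat.cast_mul, Int.cast_mul, Int.cast_natCast]
    exact w.asIdeal.mul_mem_right _ hℓw
  have hS₀mem : ∀ w ∈ S₀, ((p : ℕ) : 𝓞 K) ∉ w.asIdeal ∧
      ((w.asIdeal.under ℤ).primesOver (𝓞 K)).ncard = 2 := fun w hw ↦ by
    rw [hS₀, Finset.mem_coe, hSf] at hw
    refine ⟨hw.2, ?_⟩
    obtain ⟨ℓ, hℓ, hℓw⟩ := exists_prime_natCast_mem_asIdeal w
    haveI : Fact ℓ.Prime := ⟨hℓ⟩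
    have hunder : w.asIdeal.under ℤ = Ideal.span {(ℓ : ℤ)} :=
      (liesOver_span_int K ℓ w (by exact_mod_cast hℓw)).over.symm
    have hℓN : ℓ ∣ W.conductorNorm ℤ := by
      have hmem : ((W.conductorNorm ℤ : ℕ) : ℤ) ∈ w.asIdeal.under ℤ := by
        rw [Ideal.under_def, Ideal.mem_comap, map_natCast]
        have := hw.1
        rwa [Int.cast_natCast] at this
      rw [hunder, Ideal.mem_span_singleton] at hmem
      exact_mod_cast hmem
    rw [hunder]
    exact hH ℓ hℓ hℓN
  /- unramified outside `S₀ ∪ {w ∣ p}` -/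
  have hM : ∀ m : (W.baseChange K).geomTorsion ((p : ℕ) : ℤ),
      Continuous fun g : absoluteGaloisGroup K ↦ g • m :=
    continuous_smul_geomTorsion (W.baseChange K) ((p : ℕ) : ℤ)
  have hunrE : ∀ w : HeightOneSpectrum (𝓞 K), w ∉ S₀ → ((p : ℕ) : 𝓞 K) ∉ w.asIdeal →
      ∀ x ∈ inertia w, ∀ m : (W.baseChange K).geomTorsion ((p : ℕ) : ℤ), x • m = m :=
    fun w hw hpw x hx m ↦ smul_geomTorsion_eq_of_mem_inertia_chosen (W.baseChange K) (hgood w hw hpw) hpw hx m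
  have hunrSub : ∀ w : HeightOneSpectrum (𝓞 K), w ∉ S₀ → ((p : ℕ) : 𝓞 K) ∉ w.asIdeal →
      ∀ x ∈ inertia w, ∀ m : S.Sub, x • m = m := fun w hw hpw x hx m ↦
    S.incl_injective (by rw [StableSubgroup.incl_smul]; exact hunrE w hw hpw x hx _)
  have hunrQuot : ∀ w : HeightOneSpectrum (𝓞 K), w ∉ S₀ → ((p : ℕ) : 𝓞 K) ∉ w.asIdeal →
      ∀ x ∈ inertia w, ∀ m : S.Quot, x • m = m := fun w hw hpw x hx m ↦ by
    obtain ⟨n, rfl⟩ := S.proj_surjective m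
    rw [StableSubgroup.smul_proj, hunrE w hw hpw x hx]
  /- Brink: `v̄` is finitely decomposed in `K_∞` -/
  have h𝔭dec : ¬ (decomp vbar ≤ κ.kerSubgroup) :=
    ZpExtension.decomp_not_le_kerSubgroup_above_of_isAnticyclotomic_holds K p hK hp2' κ hκ vbar hvbar
  /- CGLS Prop. 14 for the two characters -/
  have hΦfin : (datumStrictSelmer κ.kerSubgroup S.Sub p (AcSelmer.bdpData S.Sub p vbar) S₀ :
      Set (Literature.NumberTheory.EllipticCurves.subgroupH1 κ.kerSubgroup S.Sub)).Finite :=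
    hfact K p hK hp2' hsplit κ hκ vbar hvbar S.Sub hSub (S.continuous_smul_sub hM) S₀ hS₀fin
      hS₀mem hunrSub hnon1 hωS
  have hΨfin : (datumStrictSelmer κ.kerSubgroup S.Quot p (AcSelmer.bdpData S.Quot p vbar) S₀ :
      Set (Literature.NumberTheory.EllipticCurves.subgroupH1 κ.kerSubgroup S.Quot)).Finite :=
    hfact K p hK hp2' hsplit κ hκ vbar hvbar S.Quot hQuot (S.continuous_smul_quot hM) S₀ hS₀fin
      hS₀mem hunrQuot hnon2 hωQ
  exact finite_selmerAc_pTorsion_of_line_devissage (W.baseChange K) κ hvbar h𝔭dec hgood S hfix hΦfin hΨfin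

/-- **CGLS22 Prop. 14 ⟹ `X_ac^∅(E_K[p^∞])` (Castella's dual, strict at `v̄`) is `Λ`-torsion with `μ = 0`, at every Eisenstein Heegner
datum with the non-anomalous clause above `p`** (§1 at `Sf` = places over `N_W` off `p`, `Sel^∅ ≤ Sel^{Sf}`, Greenberg's criterion (A)).
Reduction type NOT used.  CONDITIONAL on the published named fact.
[cite: CastellaGrossiLeeSkinner2022, §1.2 Prop. 14, §1.4 Props. 17–18 (arXiv:2008.02571; Invent. Math. 227 (2022))]
[cite: GreenbergLNM1716, §1 p. 60 (after Conj. 1.3)] [cite: GreenbergVatsal2000, §2 Prop. (2.8)] [cite: Castella2018, Def. 2.2] -/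
theorem isTorsion_muInvariant_eq_zero_empty_of_prop14_of_nonAnomalous
    (hfact : prop14_residualCharacterSelmer_finite)
    {p : ℕ} [Fact p.Prime] (W : WeierstrassCurve ℚ) [W.IsElliptic] [W.IsGloballyMinimal]
    (K : Type) [Field K] [NumberField K] (vbar : HeightOneSpectrum (𝓞 K))
    (κ : ZpExtension K p) (γ : absoluteGaloisGroup K) [Fact (κ.IsTopGenerator γ)]
    (hp2 : 2 < p) (hred : Red W p) (hK : IsImaginaryQuadratic K)
    (hH : SatisfiesHeegnerHypothesis (W.conductorNorm ℤ) K)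
    (hsplit : ((Ideal.span {(p : ℤ)}).primesOver (𝓞 K)).ncard = 2)
    (hvbar : ((p : ℕ) : 𝓞 K) ∈ vbar.asIdeal) (hκ : κ.IsAnticyclotomic)
    (hna : ∀ (v : HeightOneSpectrum (𝓞 ℚ)), ((p : ℕ) : 𝓞 ℚ) ∈ v.asIdeal →
      ∀ (Φ : AddSubgroup (geomTorsion W (p : ℤ))), IsRationalLine W p Φ →
      ∀ 𝔓 ∈ v.primesAbove,
        (¬ ∀ g ∈ 𝔓.decompositionSubgroup (absoluteGaloisGroup ℚ), ∀ P ∈ Φ, g • P = P) ∧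
          (¬ ∀ g ∈ 𝔓.decompositionSubgroup (absoluteGaloisGroup ℚ),
            ∀ P : geomTorsion W (p : ℤ), g • P - P ∈ Φ)) :
    Module.IsTorsion (IwasawaAlgebra p) (Castella2018.AcSelmer.XAc (W.baseChange K) p κ vbar ∅ γ) ∧
      muInvariant p (Castella2018.AcSelmer.XAc (W.baseChange K) p κ vbar ∅ γ) = 0 := by
  haveI : (W.baseChange K).IsElliptic := inferInstanceAs (W.map (algebraMap ℚ K)).IsElliptic
  have hN0 : W.conductorNorm ℤ ≠ 0 := (W.conductorNorm_pos_holds).ne'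
  obtain ⟨Sf, hSf⟩ := StubC3MultMuLemma.exists_finset_offP (K := K) hN0 p
  have hfin := residualFinite_of_prop14_of_nonAnomalous hfact W K vbar κ Sf hp2 hred hK hH hsplit hvbar hκ hSf hna
  exact KellerYinLemma511ResidualFinite.isTorsion_muInvariant_eq_zero_empty_of_residualFinite
    (W.baseChange K) κ vbar γ _ hfin

/-! ### §2 The semistable-twist cells of B6 ∩ X3 at `p ≥ 5`: [INV.μ] and the torsion clause FROM PRINT -/

/-- **At `p ≥ 5`, on BOTH semistable-twist cells (M) and (G-ord, `e = 2`) of B6 ∩ X3, `X_ac^∅(E_K[p^∞])` is `Λ`-torsion with `μ = 0`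
⟸ CGLS22 Prop. 14 (PUBLISHED)** — for every globally minimal `W/ℚ` with `ClassX3 W p` and `SubSemistableTwist W p`, every imaginary
quadratic `K` with the Heegner hypothesis for `N_W` in which `(p)` splits, every `v̄ ∋ p`, THE anticyclotomic `κ` and a topological
generator `γ`.  §1 with the non-anomalous clause supplied by `SemistableTwistLocal.not_fix_and_not_quot_of_classX3_of_subSemistableTwist`
(p663074).  These are the clauses "`𝔛` is `Λ`-torsion" and "`μ(𝔛) = 0`" of Keller–Yin arXiv:2410.23241 Thms. 3.3.6 / 3.5.1 for the
door's curves at `p ≥ 5`, now resting on a refereed theorem.  CONDITIONAL on `hfact`; nothing asserted about BSD.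
[cite: CastellaGrossiLeeSkinner2022, §1.2 Prop. 14, §1.4 Props. 17–18 (arXiv:2008.02571; Invent. Math. 227 (2022))]
[cite: KellerYin2024b, Thm. 3.3.6 clause "Λ-torsion" and Thm. 3.5.1 clause "μ(𝔛) = 0" (arXiv:2410.23241 pp. 19–20) (preprint; derived at p ≥ 5)]
[cite: Serre1972, §1.11 Prop. 11 and §1.12 Prop. 13] [cite: SilvermanAEC2009, X.5 Cor. 5.4] -/
theorem isTorsion_muInvariant_eq_zero_empty_of_prop14_of_subSemistableTwist
    (hfact : prop14_residualCharacterSelmer_finite)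
    {p : ℕ} [Fact p.Prime] (W : WeierstrassCurve ℚ) [W.IsElliptic] [W.IsGloballyMinimal]
    (K : Type) [Field K] [NumberField K] (vbar : HeightOneSpectrum (𝓞 K))
    (κ : ZpExtension K p) (γ : absoluteGaloisGroup K) [Fact (κ.IsTopGenerator γ)]
    (hp5 : 5 ≤ p) (hX : ClassX3 W p) (hS : Additive.SubSemistableTwist W p) (hK : IsImaginaryQuadratic K)
    (hH : SatisfiesHeegnerHypothesis (W.conductorNorm ℤ) K)
    (hsplit : ((Ideal.span {(p : ℤ)}).primesOver (𝓞 K)).ncard = 2)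
    (hvbar : ((p : ℕ) : 𝓞 K) ∈ vbar.asIdeal) (hκ : κ.IsAnticyclotomic) :
    Module.IsTorsion (IwasawaAlgebra p) (Castella2018.AcSelmer.XAc (W.baseChange K) p κ vbar ∅ γ) ∧
      muInvariant p (Castella2018.AcSelmer.XAc (W.baseChange K) p κ vbar ∅ γ) = 0 :=
  isTorsion_muInvariant_eq_zero_empty_of_prop14_of_nonAnomalous hfact W K vbar κ γ (by omega) hX.1 hK hH hsplit hvbar hκ
    fun _ hpv _ hΦ 𝔓 h𝔓 ↦
      SemistableTwistLocal.not_fix_and_not_quot_of_classX3_of_subSemistableTwist W p hp5 hX hS hpv h𝔓 hΦ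

/-! ### §3 The WING's field-local (G-ord, `e = 2`) co-socket at `p ≥ 5`: published facts + [DIV] only -/

/-- **The field-local (G-ord, `e = 2`) co-socket `AdditiveIMCUpperBDPInputManinAtField W p K` at `p ≥ 5` and `d_K ≠ −3` ⇐ Kolyvagin ∧
modularity ∧ Hsieh 2014 Thm. A ∧ Liu–Zhang–Zhang 2018 ∧ Castella–Hsieh signed existence ∧ CGLS 2022 Prop. 14 (ALL PUBLISHED) ∧
Keller–Yin [DIV] (Thm. 3.3.6 ∘ Prop. 3.4.4 — ONE preprint sentence).**  Generation 22's
`KYBranchHalves.additiveIMCUpperBDPInputManinAtField_of_hsieh_of_lzz_of_KY_divisibility_of_muZero_of_castellaHsieh_signed` VERBATIM with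
the `μ`-input "`μ(𝔛) = 0`" at the presented curve taken from §2 (CGLS Prop. 14 + the local clause of p663074) instead of
`thm351_muInvariant_eq_zero_OPEN`.  At `p ≥ 5` the upper half of the K1 rung on (G-ord, `e = 2`) therefore cites exactly ONE
unrefereed sentence ([DIV]).  CONDITIONAL on the displayed hypotheses; nothing asserted about BSD.
[cite: CastellaGrossiLeeSkinner2022, §1.2 Prop. 14 (arXiv:2008.02571; Invent. Math. 227 (2022))]
[cite: KellerYin2024b, Thm. 3.3.6 and Prop. 3.4.4 (arXiv:2410.23241 p. 19) (preprint; hypothesis)]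
[cite: CastellaHsieh2018, §3.3, Def. 3.7 and Prop. 3.8] [cite: Hsieh2014, Thm. A p. 712 (Doc. Math. 19)]
[cite: LiuZhangZhang2018, Thm 1.5.1 and Thm 1.5.3 (Duke Math. J. 167 pp. 748–749)] [cite: AtkinLehner1970, Thm. 4] -/
theorem additiveIMCUpperBDPInputManinAtField_of_hsieh_of_lzz_of_KY_divisibility_of_prop14_of_castellaHsieh_signed
    (hKo : ∀ (N : ℕ) [NeZero N] (W : WeierstrassCurve ℚ) (K : Type) [Field K] [NumberField K],
      Literature.NumberTheory.EllipticCurves.kolyvagin N W K)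
    (hPar : nonempty_modularParametrizationData)
    (hA : Hsieh2014.thmA_exists_isHsiehLFunction_unrPeriod_anyLevel)
    (hL : LiuZhangZhang2018.thm151_thm153_modularCurve_heegnerVector_additive)
    (hDIV : thm336_divisibility_branch_OPEN) (h14 : prop14_residualCharacterSelmer_finite)
    (hCHσ : castellaHsieh2018_exists_isBranchBDPLFunction_signed)
    {W : WeierstrassCurve ℚ} [W.IsElliptic] [W.IsGloballyMinimal] {p : ℕ} [Fact p.Prime]
    (hp5 : 5 ≤ p) (hX : ClassX3 W p) (hSG : Additive.SubGordTwo W p)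
    (hlat : ∃ Φ : AddSubgroup (geomTorsion W (p : ℤ)), IsRationalLine W p Φ ∧ ¬ LineDecompositionTrivialAt W p Φ)
    (K : Type) [Field K] [NumberField K] (hdK : NumberField.discr K ≠ -3) :
    AdditiveIMCUpperBDPInputManinAtField W p K := by
  have hp : p.Prime := Fact.out
  have hp2 : p ≠ 2 := by omega
  have hcase : W.HasGoodOrdinaryReductionOverQuadraticAt p :=
    hasGoodOrdinaryReductionOverQuadraticAt_of_subGordTwo hp2 W hX hSG
  obtain ⟨Φ₀, hΦ₀, -⟩ := id hlat
  have hred : Red W p := red_of_isRationalLine hΦ₀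
  obtain ⟨W', hE', hmin', C₂, hW, hord, hΔ⟩ :=
    exists_goodOrd_partner_presentation_of_subGordTwo_odd hp2 W hX hSG
  subst hW
  haveI : NeZero (W'.conductorNorm ℤ) := ⟨(WeierstrassCurve.conductorNorm_pos_holds W').ne'⟩
  intro N _ Dt H ι P hr' hloc hN hK hodd hunit hHe hL1 hP hnt htf κ hκ γ _ 𝔭 h𝔭 he hf
  refine additiveIMCUpperBDPOnTreeLeAt_of_kolyvagin_of_hsieh_of_lzz_of_intCoDivConj hKo hA hL hp2 hX (Or.inr hSG) Dt H ι P
    hr' hloc hN hK hodd hunit hHe hL1 hP hnt κ hκ γ 𝔭 h𝔭 he hf ?_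
  intro 𝔮 h𝔮 hne he' hf' ι' hι' ΩK Ωp Q hΩK hΩp hQ
  obtain ⟨Dt'⟩ := hPar W'
  haveI : IsGalois ℚ K := Literature.FieldTheory.Galois.isGalois_of_finrank_eq_two hK.1
  have hpN' : ¬ p ∣ W'.conductorNorm ℤ := not_dvd_conductorNorm_of_hasGoodReductionAtPrime W' hord.1
  have hmodN : exists_isNewformOf := exists_isNewformOf_of_nonempty_modularParametrizationData hPar
  have hHe' : SatisfiesHeegnerHypothesis (W'.conductorNorm ℤ) K :=
    SatisfiesHeegnerHypothesis.of_dvd (conductorNorm_partner_dvd_level hmodN hp2 W' hord.1 _ C₂ Dt) hHe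
  -- `μ(𝔛) = 0` at `v̄ = 𝔭` for the presented curve itself, FROM PRINT (CGLS Prop. 14 + the local clause at `p ≥ 5`)
  have hsplit : ((Ideal.span {(p : ℤ)}).primesOver (𝓞 K)).ncard = 2 :=
    ncard_primesOver_eq_two_of_degreeOne hK.1 h𝔭 he hf
  have hμX := (isTorsion_muInvariant_eq_zero_empty_of_prop14_of_subSemistableTwist h14 _ K 𝔭 κ γ hp5 hX (Or.inr hSG)
    hK (by rw [hN]; exact hHe) hsplit h𝔭 hκ).2
  exact span_le_xac_charIdeal_map_of_KY_divisibility_of_muInvariant_eq_zero hCHσ hDIV hmodN hp2 W' hord.1 _ C₂ Dt Dt' hpN'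
    hK hHe hHe' hodd hdK hκ γ h𝔭 he hf h𝔮 hne hι' hN hcase hred hlat htf hμX hΩK hΩp hQ

end Summit.BirchSwinnertonDyer.BirchSwinnertonDyer.Theorems.SchneiderFreeAdditiveX3.KYMuZeroOfPrint

end
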